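import Summits.QuantumFields.YangMills.Theorems.AllWindowsColdBoxBoxHighLineFPChartWeightOnSmallField
import Summits.QuantumFields.YangMills.Theorems.AllWindowsColdBoxBoxHighLineActionSandwichWilson
import Summits.QuantumFields.YangMills.Theorems.AllWindowsColdBoxBoxHighLineTripleBond
import Summits.QuantumFields.YangMills.Theorems.AllWindowsColdBoxBoxHighLineEdgeChartParity

/-!
# T-S5.13s (part 1, Wilson) — ASSEMBLY-S5 §5 SUP BOUNDS ON THE SMALL-FIELD BOX: the Wilson pieces of the tilt exponent `tiltU`
# (planner ym-idea-2 g18, `Cruxes/BoxHighWindowsSU22/ASSEMBLY-S5.md` §5 «SUP BOUNDS ON D … ⟹ sup_D |U| ≤ 1 for β ≥ β₀», routing 20:15:08Z «13s = YES, yours»;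
# letters of ✓`…Step2Wick`/`…Step2Tilt`; LINE-19 S5 ⟨stmt-QuantumFields-24004⟩/⟨24335⟩, LINE-20 U5 ⟨24336⟩)

Width seat `ym-line-sfw-p2-w4` (prover-ym-line-sfw-p2-w4-g28-0), free hands for the T-S5.13 assembler.  On `a ∈ smallField H s`, `0 ≤ s ≤ 1`:

* `TiltSup.norm_plaqVar_le` / `norm_plaqLin_le` / `sum_norm_plaqVar_le` / `sum_norm_plaqVar_sq_le` — plaquette variables are `≤ s` (✓`SmallFieldPlaq.norm_freeVec_le`);
* `TiltSup.abs_chartPlaqCost_sub_linCurvSq_le` — per plaquette, UNCONDITIONALLY: `|c_p(a) − |ℓ_p(a)|²| ≤ 100·s³`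
  (w2's ✓`WilsonSandwich.abs_chartPlaqCost_sub_norm_sq_le` + ✓`WilsonSandwich.linCurvSq_eq_norm_sq`, `‖plaqLin‖ ≤ 4s`);
* `TiltSup.abs_chartPlaqCostOdd_le` — per plaquette, UNCONDITIONALLY: `|c_p^{odd}(a)| ≤ 100·s³` (`D` is symmetric, `|ℓ_p(−a)|² = |ℓ_p(a)|²`);
  `abs_chartPlaqCost_even_rem_le` (`|c_p − |ℓ_p|² − c_p^{odd}| ≤ 200·s³`) and, GIVEN T-S5.7a `WilsonPlaquetteTaylor` as a hypothesis (verbatim),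
  `abs_chartPlaqCost_even_rem_le_of` (`≤ C·s⁴`, the quartic truth, `μ ≠ ν`);
* `TiltSup.abs_cubicVertex_add_quarticWilson_le` / `abs_cubicVertex_le` / `abs_quarticWilson_le` — UNCONDITIONALLY, `H ≥ 1`:
  `|cubicVertex + quarticWilson| ≤ 409600·|β|·H⁴·s³`, `|cubicVertex| ≤ 409600·|β|·H⁴·s³`, `|quarticWilson| ≤ 819200·|β|·H⁴·s³`
  (`cubicVertex + quarticWilson = β·Σ_{p touching}(c_p − |ℓ_p|²)` ✓`FPChartFactor.cubicVertex_add_quarticWilson`, `#plaquettesTouching ≤ 16(2H+2)⁴ ≤ 4096H⁴`).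

Part 2 (`…TiltSupBounds.lean`) adds the gauge-fixing, Haar and ghost pieces and the package `abs_tiltU_le_of (h7d : GhostTaylor)`.
Everything proved; no definitions; standard axioms.  HONEST LABEL: helper lemmas for the OPEN assembly T-S5.13 of the XL stub S5 (`stub_landauSecondOrder`) of a
critic-PASSed DRAFT line; S5, U5, ⟨24004⟩ ⟨24335⟩ ⟨24336⟩ remain OPEN; no crux, rung or summit is proved; the Yang–Mills mass gap is NOT proved by this file.
-/

set_option autoImplicit false

open MeasureTheory Real Finset Matrix
open Literature.Probability.LatticeModels (Site)
open Literature.MathematicalPhysics.QuantumFieldTheory.AxialGauge (boxEdges)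
open Literature.MathematicalPhysics.QuantumFieldTheory.Balaban1983to89.B10Eq22Rescaling (sigmaSU2)
open Literature.MathematicalPhysics.QuantumLattice (ZdPlaquette plaquettesTouching)

namespace Summit.QuantumFields.YangMills.Theorems.AllWindowsColdBoxBoxHighLine

namespace TiltSup

variable {H : ℕ}

/-! ## Plaquette variables on the small-field box -/

/-- On `smallField H s` every plaquette variable has norm `≤ s` (links off the box are `0`). -/
theorem norm_plaqVar_le {s : ℝ} (hs : 0 ≤ s) {a : LandauFree H → E3} (ha : a ∈ smallField H s) (x : Site 4) (μ ν i : Fin 4) :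
    ‖plaqVar H x μ ν a i‖ ≤ s :=
  SmallFieldPlaq.norm_freeVec_le ha hs _

/-- `‖v₀ + v₁ − v₂ − v₃‖ ≤ Σ_i ‖v_i‖`. -/
theorem norm_plaqLin_le (v : Fin 4 → E3) : ‖plaqLin v‖ ≤ ∑ i, ‖v i‖ := by
  unfold plaqLin
  rw [Fin.sum_univ_four]
  calc ‖v 0 + v 1 - v 2 - v 3‖ ≤ ‖v 0 + v 1 - v 2‖ + ‖v 3‖ := norm_sub_le _ _
    _ ≤ ‖v 0 + v 1‖ + ‖v 2‖ + ‖v 3‖ := by gcongr; exact norm_sub_le _ _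
    _ ≤ ‖v 0‖ + ‖v 1‖ + ‖v 2‖ + ‖v 3‖ := by gcongr; exact norm_add_le _ _

/-- `Σ_i ‖plaqVar_i‖ ≤ 4s` on `smallField H s`. -/
theorem sum_norm_plaqVar_le {s : ℝ} (hs : 0 ≤ s) {a : LandauFree H → E3} (ha : a ∈ smallField H s) (x : Site 4) (μ ν : Fin 4) :
    ∑ i, ‖plaqVar H x μ ν a i‖ ≤ 4 * s := by
  calc ∑ i, ‖plaqVar H x μ ν a i‖ ≤ ∑ _i : Fin 4, s := Finset.sum_le_sum fun i _ => norm_plaqVar_le hs ha x μ ν i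
    _ = 4 * s := by simp

/-- `Σ_i ‖plaqVar_i‖² ≤ 4s²` on `smallField H s`. -/
theorem sum_norm_plaqVar_sq_le {s : ℝ} (hs : 0 ≤ s) {a : LandauFree H → E3} (ha : a ∈ smallField H s) (x : Site 4) (μ ν : Fin 4) :
    ∑ i, ‖plaqVar H x μ ν a i‖ ^ 2 ≤ 4 * s ^ 2 := by
  calc ∑ i, ‖plaqVar H x μ ν a i‖ ^ 2 ≤ ∑ _i : Fin 4, s ^ 2 :=
        Finset.sum_le_sum fun i _ => pow_le_pow_left₀ (norm_nonneg _) (norm_plaqVar_le hs ha x μ ν i) 2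
    _ = 4 * s ^ 2 := by simp

/-! ## The Wilson part: unconditional cubic bound -/

/-- **Per plaquette, unconditionally**: `|c_p(a) − |ℓ_p(a)|²| ≤ 100·s³` on `smallField H s`, `0 ≤ s ≤ 1`
(w2's second-order trace estimate ✓`WilsonSandwich.abs_chartPlaqCost_sub_norm_sq_le`: `≤ 3s·‖plaqLin‖·Σ‖v_i‖ + 13s²·Σ‖v_i‖² ≤ 48s³ + 52s⁴`). -/
theorem abs_chartPlaqCost_sub_linCurvSq_le {s : ℝ} (hs0 : 0 ≤ s) (hs1 : s ≤ 1) {a : LandauFree H → E3}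
    (ha : a ∈ smallField H s) (x : Site 4) (μ ν : Fin 4) :
    |chartPlaqCost H x μ ν a - linCurvSq H (x, μ, ν) a| ≤ 100 * s ^ 3 := by
  have hv := norm_plaqVar_le hs0 ha x μ ν
  have h := WilsonSandwich.abs_chartPlaqCost_sub_norm_sq_le H x μ ν a hs0 hs1 hv
  rw [WilsonSandwich.linCurvSq_eq_norm_sq]
  have hsum := sum_norm_plaqVar_le hs0 ha x μ ν
  have hsum2 := sum_norm_plaqVar_sq_le hs0 ha x μ ν
  have hlin : ‖plaqLin (plaqVar H x μ ν a)‖ ≤ 4 * s := (norm_plaqLin_le _).trans hsum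
  have h3 : 3 * s * ‖plaqLin (plaqVar H x μ ν a)‖ * ∑ i, ‖plaqVar H x μ ν a i‖ ≤ 3 * s * (4 * s) * (4 * s) := by
    have h0 : 0 ≤ ∑ i, ‖plaqVar H x μ ν a i‖ := Finset.sum_nonneg fun i _ => norm_nonneg _
    gcongr
  have h4 : 13 * s ^ 2 * ∑ i, ‖plaqVar H x μ ν a i‖ ^ 2 ≤ 13 * s ^ 2 * (4 * s ^ 2) := by gcongr
  have hs4 : s ^ 4 ≤ s ^ 3 := pow_le_pow_of_le_one hs0 hs1 (by norm_num)
  nlinarith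

/-- `#plaquettesTouching(box) ≤ 4096·H⁴` for `H ≥ 1` (✓`card_plaquettesTouching_le`: `≤ 16(2H+2)⁴ ≤ 16(4H)⁴`). -/
theorem card_plaquettesTouching_le' (hH : 1 ≤ H) :
    ((plaquettesTouching (boxEdges 4 (2 * H + 1))).card : ℝ) ≤ 4096 * (H : ℝ) ^ 4 := by
  have h := EdgeChartGaussian.card_plaquettesTouching_le H
  have hH1 : (1 : ℝ) ≤ H := by exact_mod_cast hH
  have h2 : 2 * (H : ℝ) + 2 ≤ 4 * H := by linarith
  calc ((plaquettesTouching (boxEdges 4 (2 * H + 1))).card : ℝ) ≤ 16 * (2 * (H : ℝ) + 2) ^ 4 := h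
    _ ≤ 16 * (4 * (H : ℝ)) ^ 4 := by gcongr
    _ = 4096 * (H : ℝ) ^ 4 := by ring

/-- **The Wilson part of the tilt, unconditionally**: `|cubicVertex + quarticWilson| ≤ 409600·|β|·H⁴·s³` on `smallField H s`, `0 ≤ s ≤ 1`, `H ≥ 1`
(the odd parts cancel: `cubicVertex + quarticWilson = β·Σ_{p touching}(c_p − |ℓ_p|²)`, ✓`FPChartFactor.cubicVertex_add_quarticWilson`). -/
theorem abs_cubicVertex_add_quarticWilson_le (hH : 1 ≤ H) (β : ℝ) {s : ℝ} (hs0 : 0 ≤ s) (hs1 : s ≤ 1)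
    {a : LandauFree H → E3} (ha : a ∈ smallField H s) :
    |cubicVertex β H a + quarticWilson β H a| ≤ 409600 * |β| * (H : ℝ) ^ 4 * s ^ 3 := by
  rw [FPChartFactor.cubicVertex_add_quarticWilson, FPChartFactor.boxWilson_edgeChart_eq_sum, ← Finset.sum_sub_distrib, abs_mul]
  have hsum : |∑ p ∈ plaquettesTouching (boxEdges 4 (2 * H + 1)),
      (chartPlaqCost H p.1 p.2.1.1 p.2.1.2 a - linCurvSq H (p.1, p.2.1.1, p.2.1.2) a)| ≤
      (plaquettesTouching (boxEdges 4 (2 * H + 1))).card * (100 * s ^ 3) := by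
    refine (Finset.abs_sum_le_sum_abs _ _).trans ?_
    calc ∑ p ∈ plaquettesTouching (boxEdges 4 (2 * H + 1)),
          |chartPlaqCost H p.1 p.2.1.1 p.2.1.2 a - linCurvSq H (p.1, p.2.1.1, p.2.1.2) a|
        ≤ ∑ _p ∈ plaquettesTouching (boxEdges 4 (2 * H + 1)), 100 * s ^ 3 :=
          Finset.sum_le_sum fun p _ => abs_chartPlaqCost_sub_linCurvSq_le hs0 hs1 ha _ _ _
      _ = _ := by rw [Finset.sum_const, nsmul_eq_mul]
  have hcard := card_plaquettesTouching_le' hH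
  have hs3 : 0 ≤ s ^ 3 := by positivity
  calc |β| * |∑ p ∈ plaquettesTouching (boxEdges 4 (2 * H + 1)),
        (chartPlaqCost H p.1 p.2.1.1 p.2.1.2 a - linCurvSq H (p.1, p.2.1.1, p.2.1.2) a)|
      ≤ |β| * ((plaquettesTouching (boxEdges 4 (2 * H + 1))).card * (100 * s ^ 3)) :=
        mul_le_mul_of_nonneg_left hsum (abs_nonneg _)
    _ ≤ |β| * (4096 * (H : ℝ) ^ 4 * (100 * s ^ 3)) := by gcongr
    _ = 409600 * |β| * (H : ℝ) ^ 4 * s ^ 3 := by ring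

/-! ## Odd part and even remainder per plaquette -/

/-- **Per plaquette, unconditionally**: the odd part of the cost is cubic, `|c_p^{odd}(a)| ≤ 100·s³` on `smallField H s`, `0 ≤ s ≤ 1`
(`c^{odd} = (c(a) − c(−a))/2` and `|c(±a) − |ℓ_p|²| ≤ 100s³`, ✓`EdgeChartGaussian.linCurvSq_neg` / `neg_mem_smallField_iff`). -/
theorem abs_chartPlaqCostOdd_le {s : ℝ} (hs0 : 0 ≤ s) (hs1 : s ≤ 1) {a : LandauFree H → E3}
    (ha : a ∈ smallField H s) (x : Site 4) (μ ν : Fin 4) :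
    |chartPlaqCostOdd H x μ ν a| ≤ 100 * s ^ 3 := by
  have h1 := abs_chartPlaqCost_sub_linCurvSq_le hs0 hs1 ha x μ ν
  have h2 := abs_chartPlaqCost_sub_linCurvSq_le hs0 hs1 ((EdgeChartGaussian.neg_mem_smallField_iff s a).2 ha) x μ ν
  rw [EdgeChartGaussian.linCurvSq_neg] at h2
  rw [abs_le] at h1 h2
  rw [chartPlaqCostOdd, abs_div, abs_two, div_le_iff₀ (by norm_num : (0:ℝ) < 2), abs_le]
  constructor <;> linarith [h1.1, h1.2, h2.1, h2.2]

/-- **Per plaquette, unconditionally**: the even non-Gaussian remainder `|c_p − |ℓ_p|² − c_p^{odd}| ≤ 200·s³` on `smallField H s`, `0 ≤ s ≤ 1`. -/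
theorem abs_chartPlaqCost_even_rem_le {s : ℝ} (hs0 : 0 ≤ s) (hs1 : s ≤ 1) {a : LandauFree H → E3}
    (ha : a ∈ smallField H s) (x : Site 4) (μ ν : Fin 4) :
    |chartPlaqCost H x μ ν a - linCurvSq H (x, μ, ν) a - chartPlaqCostOdd H x μ ν a| ≤ 200 * s ^ 3 := by
  have h1 := abs_chartPlaqCost_sub_linCurvSq_le hs0 hs1 ha x μ ν
  have h2 := abs_chartPlaqCostOdd_le hs0 hs1 ha x μ ν
  calc |chartPlaqCost H x μ ν a - linCurvSq H (x, μ, ν) a - chartPlaqCostOdd H x μ ν a|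
      ≤ |chartPlaqCost H x μ ν a - linCurvSq H (x, μ, ν) a| + |chartPlaqCostOdd H x μ ν a| := abs_sub _ _
    _ ≤ 100 * s ^ 3 + 100 * s ^ 3 := add_le_add h1 h2
    _ = 200 * s ^ 3 := by ring

/-- **Per plaquette, GIVEN T-S5.7a** (hypothesis `WilsonPlaquetteTaylor`, verbatim): the even remainder is QUARTIC, `|c_p − |ℓ_p|² − c_p^{odd}| ≤ C·s⁴` on
`smallField H s`, `0 ≤ s ≤ 1`, for the plaquettes `μ < ν` (7a's first conjunct with `t = s`, ✓`WilsonSandwich.linCurvSq_eq_norm_sq`). -/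
theorem abs_chartPlaqCost_even_rem_le_of (h7a : WilsonPlaquetteTaylor) :
    ∃ C : ℝ, ∀ (H : ℕ) (s : ℝ), 0 ≤ s → s ≤ 1 → ∀ a ∈ smallField H s, ∀ (x : Site 4) (μ ν : Fin 4), μ ≠ ν →
      |chartPlaqCost H x μ ν a - linCurvSq H (x, μ, ν) a - chartPlaqCostOdd H x μ ν a| ≤ C * s ^ 4 := by
  obtain ⟨C, hC⟩ := h7a
  refine ⟨C, fun H s hs0 hs1 a ha x μ ν hμν => ?_⟩
  obtain ⟨T, -, hT⟩ := hC μ ν hμν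
  have h := (hT H x s a hs0 hs1 (norm_plaqVar_le hs0 ha x μ ν)).1
  rwa [WilsonSandwich.linCurvSq_eq_norm_sq]

/-- **The cubic vertex, unconditionally**: `|cubicVertex β H a| ≤ 409600·|β|·H⁴·s³` on `smallField H s`, `0 ≤ s ≤ 1`, `H ≥ 1`. -/
theorem abs_cubicVertex_le (hH : 1 ≤ H) (β : ℝ) {s : ℝ} (hs0 : 0 ≤ s) (hs1 : s ≤ 1)
    {a : LandauFree H → E3} (ha : a ∈ smallField H s) :
    |cubicVertex β H a| ≤ 409600 * |β| * (H : ℝ) ^ 4 * s ^ 3 := by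
  rw [cubicVertex, abs_mul]
  have hsum : |∑ p ∈ plaquettesTouching (boxEdges 4 (2 * H + 1)), chartPlaqCostOdd H p.1 p.2.1.1 p.2.1.2 a| ≤
      (plaquettesTouching (boxEdges 4 (2 * H + 1))).card * (100 * s ^ 3) := by
    refine (Finset.abs_sum_le_sum_abs _ _).trans ?_
    calc ∑ p ∈ plaquettesTouching (boxEdges 4 (2 * H + 1)), |chartPlaqCostOdd H p.1 p.2.1.1 p.2.1.2 a|
        ≤ ∑ _p ∈ plaquettesTouching (boxEdges 4 (2 * H + 1)), 100 * s ^ 3 :=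
          Finset.sum_le_sum fun p _ => abs_chartPlaqCostOdd_le hs0 hs1 ha _ _ _
      _ = _ := by rw [Finset.sum_const, nsmul_eq_mul]
  have hcard := card_plaquettesTouching_le' hH
  have hs3 : 0 ≤ s ^ 3 := by positivity
  calc |β| * |∑ p ∈ plaquettesTouching (boxEdges 4 (2 * H + 1)), chartPlaqCostOdd H p.1 p.2.1.1 p.2.1.2 a|
      ≤ |β| * ((plaquettesTouching (boxEdges 4 (2 * H + 1))).card * (100 * s ^ 3)) :=
        mul_le_mul_of_nonneg_left hsum (abs_nonneg _)
    _ ≤ |β| * (4096 * (H : ℝ) ^ 4 * (100 * s ^ 3)) := by gcongr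
    _ = 409600 * |β| * (H : ℝ) ^ 4 * s ^ 3 := by ring

/-- **The even Wilson vertex, unconditionally**: `|quarticWilson β H a| ≤ 819200·|β|·H⁴·s³` on `smallField H s`, `0 ≤ s ≤ 1`, `H ≥ 1`. -/
theorem abs_quarticWilson_le (hH : 1 ≤ H) (β : ℝ) {s : ℝ} (hs0 : 0 ≤ s) (hs1 : s ≤ 1)
    {a : LandauFree H → E3} (ha : a ∈ smallField H s) :
    |quarticWilson β H a| ≤ 819200 * |β| * (H : ℝ) ^ 4 * s ^ 3 := by
  have h1 := abs_cubicVertex_add_quarticWilson_le hH β hs0 hs1 ha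
  have h2 := abs_cubicVertex_le hH β hs0 hs1 ha
  have h : quarticWilson β H a = (cubicVertex β H a + quarticWilson β H a) - cubicVertex β H a := by ring
  rw [h]
  refine (abs_sub _ _).trans ?_
  linarith

end TiltSup

end Summit.QuantumFields.YangMills.Theorems.AllWindowsColdBoxBoxHighLine
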